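import Summits.QuantumAdvantage.QuantumAdvantage.Theorems.CubicForrelationNearExactIsExactKtThreeStructure

/-!
# Crux `CubicForrelation.NearExactIsExact` (stmt-QuantumAdvantage-14043) — the FIVE-FLAT DIVISIBILITY LEMMA for cubics:
  a light cubic support (`4·#E < 2^m`) all of whose 5-flat sections are `≡ 0 (mod 4)` is empty or an `(m−3)`-flat-sized set (`#E = 2^{m−3}`)

Certificate seat `b2b-cforr-cert` (gen 23).  HONEST FRAMING: a coding-theory BRICK (standard axioms, no `decide`, uniform in the number of
bits) for the boundary rung `Φ = 29/32` of the `n = 12` ladder: it kills the last type-O configuration (base `1024`, zero excess) in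
`…TwelveTypeO1024DeadAt2932.lean`.  NOT summit progress.

THE LEMMA (`ffl_weight`).  Let `c : 𝔽₂^m → 𝔽₂` be of degree `≤ 3` and suppose every PARAMETRISED 5-FLAT `ε ↦ b ⊕ ⊕_{εᵢ=1} aᵢ`
(`ε ∈ 𝔽₂⁵`; the directions need not be independent) carries a number of ones of `c` divisible by `4`.  If `4·#E < 2^m` (`E = {c = 1}`)
then `#E = 0` or `#E = 2^{m−3}`.

PROOF (induction on `m`).  Small `m ≤ 5` directly (for `m = 5` the identity parametrisation, for `m = 4` a degenerate one counting `E`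
twice).  For `m ≥ 6` put `u = 2^{m−4}`.  Kasami–Tokura for cubics (`kt3_weights_all`) leaves `#E ∈ {0, 2u}` or `3u ≤ #E < 4u`
(`#E = 4u − 2^{s−2}` with `s ≤ m−2`, or the exceptional `7u/2`).  In the last case look at the two sides `N₀ + N₁ = #E` of every
hyperplane pair `{⟨x,z⟩ = 0/1}`, `z ≠ 0`: both restrictions are cubics on `m−1` bits inheriting the 5-flat property (the restriction chart
is affine, and an affine image of a parametrised 5-flat is a parametrised 5-flat — `stub_affineForm` coordinatewise), and `N₀, N₁ ≥ 2u`
is impossible, so the smaller side is `< 2u = 2^{(m−1)−2}` and by induction lies in `{0, u}`; hence the character sum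
`F(z) = N₀ − N₁ = #E − 2N₁` has `|F(z)| ≥ u` for all `z ≠ 0`.  Parseval `Σ_z F(z)² = 2^m·#E` then gives
`(2^m − 1)u² ≤ #E(2^m − #E) < 4u·13u`, i.e. `16u − 1 < 52`, contradicting `u ≥ 4`.

* `ffl_affine_is_flat`: a map `𝔽₂^k → 𝔽₂ⁿ` with affine coordinates is a flat parametrisation.
* `ffl_h5_comp`: the 5-flat property pulls back along maps with affine coordinates.
* `ffl_restrict`: restriction to an affine hyperplane `{⟨x,z⟩ = b}` keeping degree, count AND the 5-flat property.
* `ffl_weight`: the lemma.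

References: T. Kasami, N. Tokura, *On the weight structure of Reed–Muller codes*, IEEE Trans. IT 16 (1970) 752–759 (through the tree's
`kt3_weights_all`); J. Ax (1964) / R. J. McEliece (1972); F. J. MacWilliams, N. J. A. Sloane (1977) Ch. 13–15.  The lemma itself is this
seat's own.  Everything below is proved from Mathlib and the tree; axioms are the standard three.
-/

set_option linter.dupNamespace false -- D-0017: single-problem summit ⇒ `QuantumAdvantage.QuantumAdvantage` by design

noncomputable section

namespace Summit.QuantumAdvantage.QuantumAdvantage.Theorems.CubicForrelation.NearExactIsExact

open Finset
open Literature.Computability.QuantumComplexity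
open Literature.Computability.QuantumComplexity.BuzetChailloux (bxor zeroVec)
open Literature.Computability.QuantumComplexity.DerivativeWalsh (W)
open Literature.Computability.QuantumComplexity.Simon (twist_eq_one_or)
open Summit.QuantumAdvantage.QuantumAdvantage.Theorems.SignedCubicForrelationNotPrBPP (knf_isDegLeFun_ip knf_isDegLeFun_comp)

/-! ### Affine maps are flat parametrisations; the 5-flat property pulls back -/

/-- A map `φ : 𝔽₂^k → 𝔽₂ⁿ` all of whose coordinates are affine is a flat parametrisation `ε ↦ b ⊕ ⊕_{εᵢ=1} aᵢ`
(`b = φ(0)`, `aᵢ = φ(eᵢ) ⊕ φ(0)`). [folklore] -/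
theorem ffl_affine_is_flat {k n : ℕ} (φ : (Fin k → Bool) → (Fin n → Bool)) (hφ : ∀ j, IsDegLeFun 1 (fun ε => φ ε j)) :
    ∃ (b : Fin n → Bool) (a : Fin k → Fin n → Bool),
      ∀ ε, φ ε = fun j => b j ^^ decide (Odd #(univ.filter fun i => ε i && a i j)) := by
  classical
  choose cv β h using fun j => stub_affineForm k _ (hφ j)
  have hinj : ∀ u v : Bool, signOf u = signOf v → u = v := by
    intro u v; cases u <;> cases v <;> norm_num [signOf]
  refine ⟨β, fun i j => cv j i, fun ε => funext fun j => ?_⟩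
  have h1 := h j ε
  rw [vg_twist_eq_signOf, ← signOf_xor] at h1
  have h2 := hinj _ _ h1
  rw [h2]
  have e : (univ.filter fun i => cv j i && ε i) = univ.filter fun i => ε i && cv j i :=
    filter_congr fun i _ => by rw [Bool.and_comm]
  rw [e]

/-- **The 5-flat property pulls back along maps with affine coordinates.**  If every parametrised 5-flat of `𝔽₂ⁿ` carries a number of
ones of `c` divisible by `4`, and `s : 𝔽₂^k → 𝔽₂ⁿ` has affine coordinates, then the same holds for `c ∘ s` on `𝔽₂^k`. [folklore] -/
theorem ffl_h5_comp {k n : ℕ} (c : (Fin n → Bool) → Bool)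
    (h5 : ∀ (b : Fin n → Bool) (a : Fin 5 → Fin n → Bool),
      4 ∣ #(univ.filter fun ε : Fin 5 → Bool =>
        c (fun j => b j ^^ decide (Odd #(univ.filter fun i => ε i && a i j))) = true))
    (s : (Fin k → Bool) → (Fin n → Bool)) (hs : ∀ j, IsDegLeFun 1 (fun y => s y j))
    (b' : Fin k → Bool) (a' : Fin 5 → Fin k → Bool) :
    4 ∣ #(univ.filter fun ε : Fin 5 → Bool =>
      c (s (fun j => b' j ^^ decide (Odd #(univ.filter fun i => ε i && a' i j)))) = true) := by
  classical
  set φ : (Fin 5 → Bool) → (Fin n → Bool) :=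
    fun ε => s (fun j => b' j ^^ decide (Odd #(univ.filter fun i => ε i && a' i j))) with hφ
  have hφdeg : ∀ j, IsDegLeFun 1 (fun ε => φ ε j) := fun j =>
    knf_isDegLeFun_comp (hs j) _ fun l => bb_isDegLeFun_bxor (isDegLeFun_const 1 (b' l)) (knf_isDegLeFun_ip fun i => a' i l)
  obtain ⟨b, a, hba⟩ := ffl_affine_is_flat φ hφdeg
  have e : (univ.filter fun ε : Fin 5 → Bool => c (φ ε) = true) =
      univ.filter fun ε => c (fun j => b j ^^ decide (Odd #(univ.filter fun i => ε i && a i j))) = true :=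
    filter_congr fun ε _ => by rw [hba ε]
  change 4 ∣ #(univ.filter fun ε : Fin 5 → Bool => c (φ ε) = true)
  rw [e]
  exact h5 b a

/-! ### Restriction to an affine hyperplane, keeping the 5-flat property -/

/-- **Restriction to an affine hyperplane with the 5-flat property.**  For `c` of degree `≤ d` on `k + 1` bits whose parametrised
5-flats all carry `≡ 0 (mod 4)` ones, a covector `z` with a pivot `z_{i₀} = 1` and `b ∈ 𝔽₂`: the restriction of `c` to `{⟨x,z⟩ = b}`,
read through the affine chart of `ktg_restrict`, is a function of degree `≤ d` on `k` bits, again with the 5-flat property, and with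
exactly `#{x : c x = 1, ⟨x,z⟩ = b}` ones. [folklore; affine invariance of `RM(d,·)`] -/
theorem ffl_restrict {k d : ℕ} (c : (Fin (k + 1) → Bool) → Bool) (hc : IsDegLeFun d c)
    (h5 : ∀ (b : Fin (k + 1) → Bool) (a : Fin 5 → Fin (k + 1) → Bool),
      4 ∣ #(univ.filter fun ε : Fin 5 → Bool =>
        c (fun j => b j ^^ decide (Odd #(univ.filter fun i => ε i && a i j))) = true))
    (z : Fin (k + 1) → Bool) (i₀ : Fin (k + 1)) (hz : z i₀ = true) (b : Bool) :
    ∃ c' : (Fin k → Bool) → Bool, IsDegLeFun d c' ∧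
      (∀ (b' : Fin k → Bool) (a' : Fin 5 → Fin k → Bool),
        4 ∣ #(univ.filter fun ε : Fin 5 → Bool =>
          c' (fun j => b' j ^^ decide (Odd #(univ.filter fun i => ε i && a' i j))) = true)) ∧
      #(univ.filter fun y => c' y = true) =
        #(univ.filter fun x => c x = true ∧ decide (Odd #(univ.filter fun i => (x i && z i) = true)) = b) := by
  classical
  -- the chart (as in `ktg_restrict`)
  set v : (Fin k → Bool) → Bool := fun y =>
    b ^^ decide (Odd #(univ.filter fun j : Fin k => (y j && z (i₀.succAbove j)) = true)) with hvdef
  set s : (Fin k → Bool) → (Fin (k + 1) → Bool) := fun y => Fin.insertNth (α := fun _ => Bool) i₀ (v y) y with hsdef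
  have hs0 : ∀ y, s y i₀ = v y := fun y => by simp [hsdef]
  have hsj : ∀ y (j : Fin k), s y (i₀.succAbove j) = y j := fun y j => by simp [hsdef]
  -- the chart lands in the hyperplane
  have hsH : ∀ y, decide (Odd #(univ.filter fun i => (s y i && z i) = true)) = b := by
    intro y
    rw [ktg_card_and_split _ _ i₀, hs0, hz, Bool.and_true]
    simp_rw [hsj]
    exact ktg_xor_parity b _
  -- and is onto it
  have hsr : ∀ x : Fin (k + 1) → Bool, decide (Odd #(univ.filter fun i => (x i && z i) = true)) = b →
      s (Fin.removeNth (α := fun _ => Bool) i₀ x) = x := by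
    intro x hx
    rw [ktg_card_and_split _ _ i₀, hz, Bool.and_true] at hx
    have hv : v (Fin.removeNth (α := fun _ => Bool) i₀ x) = x i₀ := by
      simp only [hvdef, Fin.removeNth]
      exact ktg_xor_parity' (x i₀) b _ hx
    simp only [hsdef]
    rw [hv]
    exact Fin.insertNth_self_removeNth (α := fun _ => Bool) i₀ x
  -- the chart has affine coordinates
  have hsdeg : ∀ j, IsDegLeFun 1 (fun y => s y j) := by
    intro j
    rcases Fin.eq_self_or_eq_succAbove i₀ j with hj | ⟨j', hj⟩
    · have e : (fun y => s y j) = v := funext fun y => by rw [hj, hs0]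
      rw [e]
      exact bb_isDegLeFun_bxor (isDegLeFun_const 1 b) (knf_isDegLeFun_ip fun j => z (i₀.succAbove j))
    · have e : (fun y => s y j) = fun y => y j' := funext fun y => by rw [hj, hsj]
      rw [e]
      exact isDegLeFun_apply j' le_rfl
  refine ⟨fun y => c (s y), knf_isDegLeFun_comp hc s hsdeg, fun b' a' => ffl_h5_comp c h5 s hsdeg b' a', ?_⟩
  -- counting through the chart
  refine card_nbij' s (fun x => Fin.removeNth (α := fun _ => Bool) i₀ x) (fun y hy => ?_) (fun x hx => ?_)
    (fun y _ => Fin.removeNth_insertNth (α := fun _ => Bool) i₀ (v y) y) (fun x hx => ?_)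
  · rw [mem_coe, mem_filter] at hy
    rw [mem_coe, mem_filter]
    exact ⟨mem_univ _, hy.2, hsH y⟩
  · rw [mem_coe, mem_filter] at hx
    rw [mem_coe, mem_filter]
    refine ⟨mem_univ _, ?_⟩
    show c (s (Fin.removeNth (α := fun _ => Bool) i₀ x)) = true
    rw [hsr x hx.2.2]; exact hx.2.1
  · rw [mem_coe, mem_filter] at hx
    exact hsr x hx.2.2

/-! ### The lemma -/

/-- The identity parametrisation of `𝔽₂⁵` by itself counts the support once. [folklore] -/
theorem ffl_identity_count (c : (Fin 5 → Bool) → Bool) :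
    #(univ.filter fun ε : Fin 5 → Bool =>
      c (fun j => (fun _ : Fin 5 => false) j ^^ decide (Odd #(univ.filter fun i => ε i && decide (i = j)))) = true) =
      #(univ.filter fun x : Fin 5 → Bool => c x = true) := by
  classical
  have hpt : ∀ ε : Fin 5 → Bool,
      (fun j => (fun _ : Fin 5 => false) j ^^ decide (Odd #(univ.filter fun i => ε i && decide (i = j)))) = ε := by
    intro ε
    funext j
    have e : (univ.filter fun i : Fin 5 => ε i && decide (i = j)) = if ε j = true then {j} else ∅ := by
      ext i
      by_cases hij : i = j
      · subst hij
        cases h : ε i <;> simp [h]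
      · cases h : ε j <;> simp [hij]
    rw [e]
    cases h : ε j <;> simp
  exact congrArg card (filter_congr fun ε _ => by rw [hpt ε])

/-- **Base case `m = 5`**: the whole space is a 5-flat, so `4 ∣ #E`; with `#E ≤ 7` this gives `#E ∈ {0, 4}`. [this work] -/
theorem ffl_weight_five (c : (Fin 5 → Bool) → Bool)
    (h5 : ∀ (b : Fin 5 → Bool) (a : Fin 5 → Fin 5 → Bool),
      4 ∣ #(univ.filter fun ε : Fin 5 → Bool =>
        c (fun j => b j ^^ decide (Odd #(univ.filter fun i => ε i && a i j))) = true))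
    (h4 : 4 * #(univ.filter fun x => c x = true) < 2 ^ 5) :
    #(univ.filter fun x => c x = true) = 0 ∨ #(univ.filter fun x => c x = true) = 2 ^ (5 - 3) := by
  classical
  have h := h5 (fun _ => false) (fun i j => decide (i = j))
  rw [ffl_identity_count] at h
  obtain ⟨t, ht⟩ := h
  have e : (2 : ℕ) ^ (5 - 3) = 4 := by norm_num
  have e' : (2 : ℕ) ^ 5 = 32 := by norm_num
  rw [e]
  rw [e'] at h4
  omega

/-- **The five-flat divisibility lemma.**  For `m ≥ 5` and `c : 𝔽₂^m → 𝔽₂` of degree `≤ 3` such that every parametrised 5-flat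
`ε ↦ b ⊕ ⊕_{εᵢ=1} aᵢ` carries a number of ones of `c` divisible by `4`: if `4·#E < 2^m` then `#E = 0` or `#E = 2^{m−3}`.
See the module docstring for the proof. [this work] -/
theorem ffl_weight : ∀ (m : ℕ), 5 ≤ m → ∀ (c : (Fin m → Bool) → Bool), IsDegLeFun 3 c →
    (∀ (b : Fin m → Bool) (a : Fin 5 → Fin m → Bool),
      4 ∣ #(univ.filter fun ε : Fin 5 → Bool =>
        c (fun j => b j ^^ decide (Odd #(univ.filter fun i => ε i && a i j))) = true)) →
    4 * #(univ.filter fun x => c x = true) < 2 ^ m →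
      #(univ.filter fun x => c x = true) = 0 ∨ #(univ.filter fun x => c x = true) = 2 ^ (m - 3) := by
  intro m
  induction m with
  | zero => intro h; omega
  | succ k ih =>
    intro hk c hc h5 h4
    classical
    rcases Nat.lt_or_ge k 5 with hk5 | hk5
    · -- `m = 5`
      obtain rfl : k = 4 := by omega
      exact ffl_weight_five c h5 h4
    -- `m = k + 1 ≥ 6`; `u = 2^{k-3}`
    have ih' := ih hk5
    obtain ⟨κ, hκ⟩ : ∃ κ, k = κ + 3 := ⟨k - 3, by omega⟩
    set u : ℕ := 2 ^ κ with hudef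
    have hu4 : 4 ≤ u := by
      have : 2 ^ 2 ≤ 2 ^ κ := Nat.pow_le_pow_right (by norm_num) (by omega)
      rw [hudef]; simpa using this
    have h2k1 : 2 ^ (k + 1) = 16 * u := by rw [hκ, hudef, pow_add, pow_succ]; ring
    have h2k : 2 ^ k = 8 * u := by rw [hκ, hudef, pow_add]; ring
    have h2k3 : 2 ^ (k - 3) = u := by rw [hκ, hudef]; simp
    have h2m3 : 2 ^ (k + 1 - 3) = 2 * u := by rw [show k + 1 - 3 = κ + 1 by omega, hudef, pow_succ]; ring
    set S := univ.filter (fun x : Fin (k + 1) → Bool => c x = true) with hSdef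
    set w := #S with hwdef
    rw [h2m3]
    -- Kasami–Tokura: `w ∈ {0, 2u}` or `3u ≤ w < 4u`
    have hKT : w = 0 ∨ w = 2 * u ∨ (3 * u ≤ w ∧ w < 4 * u) := by
      rcases kt3_weights_all c hc h4 with h0 | ⟨s, hs, hs2⟩ | hex
      · exact Or.inl h0
      · change 4 * w + 2 ^ s = 2 ^ (k + 1) at hs
        rw [h2k1] at hs
        rcases Nat.eq_zero_or_pos w with h0 | hpos
        · exact Or.inl h0
        right
        have hslt : s < k + 1 := by
          by_contra hcon
          have : 2 ^ (k + 1) ≤ 2 ^ s := Nat.pow_le_pow_right (by norm_num) (by omega)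
          omega
        rcases Nat.lt_or_ge s k with hsk | hsk
        · right
          have : 2 ^ s ≤ 2 ^ (k - 1) := Nat.pow_le_pow_right (by norm_num) (by omega)
          have e : 2 ^ (k - 1) = 4 * u := by rw [show k - 1 = κ + 2 by omega, hudef, pow_add]; ring
          omega
        · left
          have hs_eq : s = k := by omega
          rw [hs_eq, h2k] at hs
          omega
      · right; right
        change 32 * w = 7 * 2 ^ (k + 1) at hex
        rw [h2k1] at hex
        omega
    rcases hKT with h0 | h2 | ⟨hlo, hhi⟩
    · exact Or.inl h0
    · exact Or.inr h2
    exfalso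
    -- hyperplane sections
    set ℓ : (Fin (k + 1) → Bool) → (Fin (k + 1) → Bool) → Bool :=
      fun z x => decide (Odd #(univ.filter fun i => (x i && z i) = true)) with hℓdef
    have hsec : ∀ z : Fin (k + 1) → Bool, z ≠ zeroVec → ∀ β : Bool,
        4 * #(univ.filter fun x => c x = true ∧ ℓ z x = β) < 2 ^ k →
        #(univ.filter fun x => c x = true ∧ ℓ z x = β) = 0 ∨ #(univ.filter fun x => c x = true ∧ ℓ z x = β) = u := by
      intro z hz β hlt
      obtain ⟨i₀, hi₀⟩ : ∃ i, z i = true := by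
        by_contra h
        push Not at h
        exact hz (funext fun i => by simpa [zeroVec] using h i)
      obtain ⟨c', hc', h5', hcard'⟩ := ffl_restrict c hc h5 z i₀ hi₀ β
      have h := ih' c' hc' h5' (by rw [hcard']; exact hlt)
      rw [hcard', h2k3] at h
      exact h
    have hhalf : ∀ z, #(univ.filter fun x => c x = true ∧ ℓ z x = true) + #(univ.filter fun x => c x = true ∧ ℓ z x = false) = w :=
      fun z => ktg_half_add c z
    -- `|F(z)| ≥ u` off zero
    have hw3 : (3 * u : ℝ) ≤ w := by exact_mod_cast hlo
    have hu4' : (4 : ℝ) ≤ u := by exact_mod_cast hu4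
    have hF : ∀ z : Fin (k + 1) → Bool, z ≠ zeroVec → (u : ℝ) ^ 2 ≤ (∑ x ∈ S, twist x z) ^ 2 := by
      intro z hz
      have hFz := ktg_F_half c z
      change ∑ x ∈ S, twist x z = (w : ℝ) - 2 * (#(univ.filter fun x => c x = true ∧ ℓ z x = true) : ℝ) at hFz
      set N₁ := #(univ.filter fun x => c x = true ∧ ℓ z x = true) with hN₁
      set N₀ := #(univ.filter fun x => c x = true ∧ ℓ z x = false) with hN₀
      have hsum : N₁ + N₀ = w := hhalf z
      have hsumR : (N₁ : ℝ) + N₀ = w := by exact_mod_cast hsum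
      rw [hFz]
      rcases Nat.lt_or_ge N₁ (2 * u) with h1 | h1
      · have hv := hsec z hz true (by rw [← hN₁, h2k]; omega)
        rw [← hN₁] at hv
        have hvR : (N₁ : ℝ) = 0 ∨ (N₁ : ℝ) = u := by
          rcases hv with hv | hv
          · left; exact_mod_cast hv
          · right; exact_mod_cast hv
        have hge : (u : ℝ) ≤ (w : ℝ) - 2 * (N₁ : ℝ) := by
          rcases hvR with h | h <;> rw [h] <;> linarith
        exact pow_le_pow_left₀ (by positivity) hge 2
      · have h0lt : N₀ < 2 * u := by omega
        have hv := hsec z hz false (by rw [← hN₀, h2k]; omega)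
        rw [← hN₀] at hv
        have hvR : (N₀ : ℝ) = 0 ∨ (N₀ : ℝ) = u := by
          rcases hv with hv | hv
          · left; exact_mod_cast hv
          · right; exact_mod_cast hv
        have hle : (u : ℝ) ≤ -((w : ℝ) - 2 * (N₁ : ℝ)) := by
          rcases hvR with h | h <;> rw [h] at hsumR <;> linarith
        have h := pow_le_pow_left₀ (by positivity) hle 2
        rw [neg_sq] at h
        exact h
    -- Parseval
    have hP := ktg_parseval S
    have hF0 : ∑ x ∈ S, twist x zeroVec = (w : ℝ) := by
      rw [sum_congr rfl fun x _ => BuzetChailloux.twist_zeroVec_right x, sum_const, nsmul_eq_mul, mul_one]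
    have hsplit : ∑ z, (∑ x ∈ S, twist x z) ^ 2 =
        (∑ x ∈ S, twist x zeroVec) ^ 2 + ∑ z ∈ univ.erase zeroVec, (∑ x ∈ S, twist x z) ^ 2 :=
      (add_sum_erase univ (fun z => (∑ x ∈ S, twist x z) ^ 2) (mem_univ _)).symm
    have hcardE : #(univ.erase (zeroVec : Fin (k + 1) → Bool)) = 16 * u - 1 := by
      rw [card_erase_of_mem (mem_univ _), card_univ, Fintype.card_fun, Fintype.card_bool, Fintype.card_fin, h2k1]
    have hlow : ((16 * u - 1 : ℕ) : ℝ) * (u : ℝ) ^ 2 ≤ ∑ z ∈ univ.erase zeroVec, (∑ x ∈ S, twist x z) ^ 2 := by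
      have h := sum_le_sum (s := univ.erase (zeroVec : Fin (k + 1) → Bool)) (f := fun _ => (u : ℝ) ^ 2)
        (g := fun z => (∑ x ∈ S, twist x z) ^ 2) (fun z hz => hF z (ne_of_mem_erase hz))
      rw [sum_const, hcardE, nsmul_eq_mul] at h
      exact h
    rw [hsplit, hF0] at hP
    have hN : ((2 : ℝ) ^ (k + 1)) = 16 * (u : ℝ) := by exact_mod_cast h2k1
    rw [hN] at hP
    have hu1 : 1 ≤ 16 * u := by omega
    have hw4 : (w : ℝ) + 1 ≤ 4 * u := by exact_mod_cast (by omega : w + 1 ≤ 4 * u)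
    have hcast : ((16 * u - 1 : ℕ) : ℝ) = 16 * (u : ℝ) - 1 := by push_cast [hu1]; ring
    rw [hcast] at hlow
    nlinarith

end Summit.QuantumAdvantage.QuantumAdvantage.Theorems.CubicForrelation.NearExactIsExact

end
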